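import Summits.NavierStokesRegularity.NavierStokesRegularity.Theses.RellichScar
import Summits.NavierStokesRegularity.NavierStokesRegularity.Theorems.ScarRigidity.Negative.LogicAndLoadBearing
import Summits.NavierStokesRegularity.NavierStokesRegularity.Theorems.RellichScarDefs
import Summits.NavierStokesRegularity.NavierStokesRegularity.Theorems.RellichScarScarRigidityApexRegularity
import Summits.NavierStokesRegularity.NavierStokesRegularity.Theorems.RellichScarScarRigidityMomentLadderReduction
import Summits.NavierStokesRegularity.NavierStokesRegularity.Theorems.SqueezeCycleNoApexTypeIProfileTypeIBoundIdle
import Literature.Analysis.FluidPDE.TypeIAncientMild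
import Literature.Analysis.FluidPDE.ClassicalSuitable
import HarnessLib

/-!
# `ScarRigidity` — bookkeeping-free normal forms of the crux
# (crux stmt-NavierStokesRegularity-11717, route RellichScar; lead c2, `--supports`)

Sorry-free, no definitions.  Two equivalent restatements of the route decl `RellichScar.ScarRigidity`, for the planners'
standing restate decision (`Cruxes/ScarRigidity/RESTATE-recommendation-ideator6.md`) and for future lines, which all work
in the smooth mild class from their first step:

* `scarRigidity_iff_mild` — **MILD NORMAL FORM.**  The crux is equivalent to its statement for PAIRS OF SMOOTH TYPE-I
  ANCIENT MILD FIELDS `V₁, V₂` (`IsTypeIAncientMild C Vᵢ`, apex bound `HasTypeIDecay C Vᵢ`, `0 < C`) that are classical for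
  pressures `Qᵢ` obeying the scale-invariant package `ScaleInvariantBounds Vᵢ Qᵢ`, both backward-singular at the origin,
  with the same scar — concluding POINTWISE equality `V₁ = V₂` on `t < 0`.  No weak gradients, no `𝐈 < ∞`, no a.e.
  (`→`: a classical pair with the package is suitable weak on the slab with weak gradient `∇V` and `𝐈 < ∞`
  (`apexClass_of_package`, the envelope bound of `NoApexEnvelope`), and a.e.-equal continuous fields agree on the open slab;
  `←`: only `0 < C` carries content, every apex profile is a.e. a Type-I ancient mild field
  (`NoApexKNSS.exists_typeIAncientMild_repr_of_hasTypeIDecay`, KNSS 2009 §4) carrying its Riesz pressure and package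
  (`stub_apexRegularity`), and the scar / the singular apex / the conclusion pass along a.e. equalities.)
* `scarRigidity_iff_knss` — **KNSS FORM.**  In the crux as filed, the weak gradients `G₁, G₂` and Albritton–Barker's
  `𝐈 < ∞` are IDLE: the crux is equivalent to the same statement for bare suitable weak solutions on the slab with the apex
  bound (the analogue for the target is `NoApexKNSS.noApexTypeIProfile_iff_knss`, p136775).

Dependencies (all landed): `scarRigidity_iff_pos`, `pos_const_of_apexSingular` (Negative/LogicAndLoadBearing);
`MomentLadder.sameScar_congr_ae`, `.isBackwardSingularPoint_congr_ae`, `.ae_slab_of_forall`; `stub_apexRegularity` (p116186);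
`NoApexEnvelope.typeIBound_slab_lt_top_of_envelopes` (p136431/p136556); `NoApexKNSS.exists_typeIAncientMild_repr_of_hasTypeIDecay`.
-/

noncomputable section

-- the sub-problem namespace repeats the summit name (D-0017 layout `Summit.<S>.<P>.Theorems`)
set_option linter.dupNamespace false

namespace Summit.NavierStokesRegularity.NavierStokesRegularity.Theorems.RellichScarScarRigidity

open Set Filter Function MeasureTheory Metric TopologicalSpace
open scoped Topology ENNReal NNReal InnerProductSpace RealInnerProductSpace
open Literature.Analysis.FluidPDE
open Literature.Analysis
open Summit.NavierStokesRegularity.NavierStokesRegularity.Theses.RellichScar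
open Summit.NavierStokesRegularity.NavierStokesRegularity.Theorems.ScarRigidity.Negative
open Summit.NavierStokesRegularity.NavierStokesRegularity.Theorems.NoApexEnvelope
  (typeIBound_slab_lt_top_of_envelopes)
open Summit.NavierStokesRegularity.NavierStokesRegularity.Theorems.NoApexKNSS
  (exists_typeIAncientMild_repr_of_hasTypeIDecay)
open Literature.Analysis.FluidPDE.ParabolicBump (continuous_frobeniusNormSq₃)
open MomentLadder

/-! ## A smooth mild pair with the package is an apex profile of the full Albritton–Barker class -/

/-- **A classical pair with the scale-invariant package lies in the full apex class.**  If `V` is a Type-I ancient mild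
field with the apex bound, classical on `(−∞,0)` for the pressure `Q`, and `(V, Q)` obeys `ScaleInvariantBounds`, then
`(V, Q)` is a suitable weak solution on the slab (CKN 1982 §2: classical solutions are suitable), `∇V` is a weak spatial
gradient, and Albritton–Barker's `𝐈(ℝ³ × ℝ₋) < ∞` (envelopes `‖∇V‖, |Q| ≤ L/(‖x‖+√(−t))²` at orders `1`, `0` of the
package feed `typeIBound_slab_lt_top_of_envelopes`).  Same proof as `NoApexKNSS.exists_pressure_typeIBound_lt_top`, for a
GIVEN pressure. [cite: CaffarelliKohnNirenberg1982, §2 (2.1)–(2.5)] [cite: AlbrittonBarker2019, §1] -/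
theorem apexClass_of_package {V : ℝ → (EuclideanSpace ℝ (Fin 3)) → (EuclideanSpace ℝ (Fin 3))} {Q : ℝ → (EuclideanSpace ℝ (Fin 3)) → ℝ} {C : ℝ}
    (hV : IsTypeIAncientMild C V) (hdV : HasTypeIDecay C V)
    (hcl : IsClassicalNSSolutionOn (Iio (0 : ℝ)) 1 0 V Q) (hSIB : ScaleInvariantBounds V Q) :
    IsSuitableWeakSolutionOn (slab (EuclideanSpace ℝ (Fin 3)) (Iio (0 : ℝ)) isOpen_Iio) 1 0 V Q ∧
      HasWeakSpatialGradientOn (slab (EuclideanSpace ℝ (Fin 3)) (Iio (0 : ℝ)) isOpen_Iio) V (fun t x => fderiv ℝ (V t) x) ∧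
      typeIBound (Iio (0 : ℝ) ×ˢ univ) V Q (fun t x => fderiv ℝ (V t) x) < ⊤ := by
  -- adapted from `NoApexKNSS.exists_pressure_typeIBound_lt_top` (the pressure is now given, not produced)
  have hQ : (((slab (EuclideanSpace ℝ (Fin 3)) (Iio (0 : ℝ)) isOpen_Iio) : Opens (ℝ × (EuclideanSpace ℝ (Fin 3)))) : Set (ℝ × (EuclideanSpace ℝ (Fin 3)))) ⊆ Iio (0 : ℝ) ×ˢ univ := by rw [coe_slab]
  refine ⟨?_, ?_, ?_⟩
  · refine isSuitableWeakSolutionOn_of_contDiffOn isOpen_Iio hQ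
      (hcl.smooth_velocity.of_le (by norm_cast)) (hcl.smooth_pressure.of_le (by norm_cast))
      continuousOn_const (fun t ht x => ?_) hcl.divFree
    have hm := hcl.momentum t ht x
    rwa [timeDerivWithin_apply, derivWithin_of_isOpen isOpen_Iio ht, ← timeDeriv_apply] at hm
  · exact hasWeakSpatialGradientOn_of_contDiffOn isOpen_Iio hQ (hV.contDiffOn.of_le (by norm_cast))
  · -- envelopes at orders `0` (pressure) and `1` (velocity gradient), one constant
    obtain ⟨L₀, h0⟩ := hSIB 0
    obtain ⟨L₁, h1⟩ := hSIB 1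
    have hGenv : ∀ t < 0, ∀ x, ‖fderiv ℝ (V t) x‖ ≤ max L₀ L₁ / (‖x‖ + Real.sqrt (-t)) ^ 2 := by
      intro t ht x
      have h := (h1 t ht x).1
      rw [norm_iteratedFDeriv_one] at h
      have hw : 0 < (‖x‖ + Real.sqrt (-t)) ^ 2 := by
        have := Real.sqrt_pos.2 (neg_pos.2 ht); positivity
      exact h.trans (div_le_div_of_nonneg_right (le_max_right _ _) hw.le)
    have hQenv : ∀ t < 0, ∀ x, |Q t x| ≤ max L₀ L₁ / (‖x‖ + Real.sqrt (-t)) ^ 2 := by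
      intro t ht x
      have h := (h0 t ht x).2.1
      rw [norm_iteratedFDeriv_zero, Real.norm_eq_abs, add_zero] at h
      have hw : 0 < (‖x‖ + Real.sqrt (-t)) ^ 2 := by
        have := Real.sqrt_pos.2 (neg_pos.2 ht); positivity
      exact h.trans (div_le_div_of_nonneg_right (le_max_left _ _) hw.le)
    -- measurability (everything is continuous on the open slab)
    have hS : MeasurableSet (Iio (0 : ℝ) ×ˢ (univ : Set (EuclideanSpace ℝ (Fin 3)))) :=
      measurableSet_Iio.prod MeasurableSet.univ
    have hVm : AEMeasurable (uncurry V) (volume.restrict (Iio (0 : ℝ) ×ˢ (univ : Set (EuclideanSpace ℝ (Fin 3))))) :=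
      hV.continuousOn_uncurry.aemeasurable hS
    have hQm : AEStronglyMeasurable (uncurry Q) (volume.restrict (Iio (0 : ℝ) ×ˢ (univ : Set (EuclideanSpace ℝ (Fin 3))))) :=
      hcl.smooth_pressure.continuousOn.aestronglyMeasurable hS
    have hGc : ContinuousOn (fun q : ℝ × (EuclideanSpace ℝ (Fin 3)) => fderiv ℝ (V q.1) q.2) (Iio (0 : ℝ) ×ˢ univ) :=
      continuousOn_fderiv_slice_of_contDiffOn (hV.contDiffOn.of_le (by norm_cast))
        isOpen_Iio.uniqueDiffOn
    have hGm : AEMeasurable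
        (fun q : ℝ × (EuclideanSpace ℝ (Fin 3)) => ENNReal.ofReal (frobeniusNormSq (fderiv ℝ (V q.1) q.2)))
        (volume.restrict (Iio (0 : ℝ) ×ˢ (univ : Set (EuclideanSpace ℝ (Fin 3))))) :=
      (ENNReal.continuous_ofReal.comp_continuousOn
        (continuous_frobeniusNormSq₃.comp_continuousOn hGc)).aemeasurable hS
    exact typeIBound_slab_lt_top_of_envelopes hVm hQm hGm hdV hGenv hQenv

/-! ## The three implications -/

/-- **Crux ⇒ mild form.**  Apply the crux to a smooth mild pair (in the full class by `apexClass_of_package`) and upgrade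
the a.e. conclusion to pointwise equality on the open slab by continuity (`Measure.eqOn_open_of_ae_eq`). -/
theorem mildScarRigidity_of_scarRigidity (h : ScarRigidity) :
    ∀ (V₁ V₂ : ℝ → (EuclideanSpace ℝ (Fin 3)) → (EuclideanSpace ℝ (Fin 3))) (Q₁ Q₂ : ℝ → (EuclideanSpace ℝ (Fin 3)) → ℝ) (C : ℝ), 0 < C →
      IsTypeIAncientMild C V₁ → IsTypeIAncientMild C V₂ → HasTypeIDecay C V₁ → HasTypeIDecay C V₂ →
      IsClassicalNSSolutionOn (Iio (0 : ℝ)) 1 0 V₁ Q₁ → IsClassicalNSSolutionOn (Iio (0 : ℝ)) 1 0 V₂ Q₂ →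
      ScaleInvariantBounds V₁ Q₁ → ScaleInvariantBounds V₂ Q₂ →
      IsBackwardSingularPoint V₁ 0 → IsBackwardSingularPoint V₂ 0 → SameScar V₁ V₂ →
      ∀ t < 0, ∀ x : (EuclideanSpace ℝ (Fin 3)), V₁ t x = V₂ t x := by
  intro V₁ V₂ Q₁ Q₂ C _ hm₁ hm₂ hd₁ hd₂ hcl₁ hcl₂ hB₁ hB₂ hs₁ hs₂ hscar
  obtain ⟨hsw₁, hwg₁, hI₁⟩ := apexClass_of_package hm₁ hd₁ hcl₁ hB₁
  obtain ⟨hsw₂, hwg₂, hI₂⟩ := apexClass_of_package hm₂ hd₂ hcl₂ hB₂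
  have hae : uncurry V₁ =ᵐ[volume.restrict (Iio (0 : ℝ) ×ˢ (univ : Set (EuclideanSpace ℝ (Fin 3))))] uncurry V₂ :=
    h V₁ Q₁ _ V₂ Q₂ _ C hsw₁ hwg₁ hI₁ hd₁ hsw₂ hwg₂ hI₂ hd₂ hs₁ hs₂ hscar
  have heq : EqOn (uncurry V₁) (uncurry V₂) (Iio (0 : ℝ) ×ˢ (univ : Set (EuclideanSpace ℝ (Fin 3)))) :=
    Measure.eqOn_open_of_ae_eq hae (isOpen_Iio.prod isOpen_univ) hm₁.continuousOn_uncurry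
      hm₂.continuousOn_uncurry
  intro t ht x
  exact heq (show ((t, x) : ℝ × (EuclideanSpace ℝ (Fin 3))) ∈ Iio (0 : ℝ) ×ˢ (univ : Set (EuclideanSpace ℝ (Fin 3))) from ⟨ht, mem_univ _⟩)

/-- **Mild form ⇒ KNSS form.**  Only `0 < C` carries content (`pos_const_of_apexSingular`); every suitable weak solution
on the slab with the apex bound is a.e. a smooth Type-I ancient mild field with the same bound (KNSS 2009 §4,
`exists_typeIAncientMild_repr_of_hasTypeIDecay`), classical for its Riesz pressure with the scale-invariant package
(`stub_apexRegularity`); the scar and the singular apex pass to the representatives, the pointwise conclusion passes back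
as an a.e. equality. [cite: KochNadirashviliSereginSverak2009, §4 Prop. 4.1] -/
theorem knssScarRigidity_of_mild
    (h : ∀ (V₁ V₂ : ℝ → (EuclideanSpace ℝ (Fin 3)) → (EuclideanSpace ℝ (Fin 3))) (Q₁ Q₂ : ℝ → (EuclideanSpace ℝ (Fin 3)) → ℝ) (C : ℝ), 0 < C →
      IsTypeIAncientMild C V₁ → IsTypeIAncientMild C V₂ → HasTypeIDecay C V₁ → HasTypeIDecay C V₂ →
      IsClassicalNSSolutionOn (Iio (0 : ℝ)) 1 0 V₁ Q₁ → IsClassicalNSSolutionOn (Iio (0 : ℝ)) 1 0 V₂ Q₂ →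
      ScaleInvariantBounds V₁ Q₁ → ScaleInvariantBounds V₂ Q₂ →
      IsBackwardSingularPoint V₁ 0 → IsBackwardSingularPoint V₂ 0 → SameScar V₁ V₂ →
      ∀ t < 0, ∀ x : (EuclideanSpace ℝ (Fin 3)), V₁ t x = V₂ t x) :
    ∀ (u₁ : ℝ → (EuclideanSpace ℝ (Fin 3)) → (EuclideanSpace ℝ (Fin 3))) (p₁ : ℝ → (EuclideanSpace ℝ (Fin 3)) → ℝ) (u₂ : ℝ → (EuclideanSpace ℝ (Fin 3)) → (EuclideanSpace ℝ (Fin 3))) (p₂ : ℝ → (EuclideanSpace ℝ (Fin 3)) → ℝ) (C : ℝ),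
      IsSuitableWeakSolutionOn (slab (EuclideanSpace ℝ (Fin 3)) (Iio (0 : ℝ)) isOpen_Iio) 1 0 u₁ p₁ → HasTypeIDecay C u₁ →
      IsSuitableWeakSolutionOn (slab (EuclideanSpace ℝ (Fin 3)) (Iio (0 : ℝ)) isOpen_Iio) 1 0 u₂ p₂ → HasTypeIDecay C u₂ →
      IsBackwardSingularPoint u₁ 0 → IsBackwardSingularPoint u₂ 0 → SameScar u₁ u₂ →
      uncurry u₁ =ᵐ[volume.restrict (Iio (0 : ℝ) ×ˢ (univ : Set (EuclideanSpace ℝ (Fin 3))))] uncurry u₂ := by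
  intro u₁ p₁ u₂ p₂ C hs₁ hd₁ hs₂ hd₂ hsing₁ hsing₂ hscar
  have hC : 0 < C := pos_const_of_apexSingular hd₁ hsing₁
  obtain ⟨V₁, hae₁, hm₁, hdV₁⟩ := exists_typeIAncientMild_repr_of_hasTypeIDecay hs₁ hd₁
  obtain ⟨V₂, hae₂, hm₂, hdV₂⟩ := exists_typeIAncientMild_repr_of_hasTypeIDecay hs₂ hd₂
  obtain ⟨Q₁, hcl₁, hB₁⟩ := stub_apexRegularity V₁ C hC hm₁ hdV₁
  obtain ⟨Q₂, hcl₂, hB₂⟩ := stub_apexRegularity V₂ C hC hm₂ hdV₂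
  have hscarV : SameScar V₁ V₂ := sameScar_congr_ae hae₁ hae₂ hscar
  have hsV₁ : IsBackwardSingularPoint V₁ 0 := isBackwardSingularPoint_congr_ae hae₁ hsing₁
  have hsV₂ : IsBackwardSingularPoint V₂ 0 := isBackwardSingularPoint_congr_ae hae₂ hsing₂
  have heq := h V₁ V₂ Q₁ Q₂ C hC hm₁ hm₂ hdV₁ hdV₂ hcl₁ hcl₂ hB₁ hB₂ hsV₁ hsV₂ hscarV
  have hV : uncurry V₁ =ᵐ[volume.restrict (Iio (0 : ℝ) ×ˢ (univ : Set (EuclideanSpace ℝ (Fin 3))))] uncurry V₂ :=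
    ae_slab_of_forall (P := fun z => uncurry V₁ z = uncurry V₂ z) fun t ht x => heq t ht x
  exact (hae₁.symm.trans hV).trans hae₂

/-- **KNSS form ⇒ crux** (drop the weak gradients and `𝐈 < ∞`). -/
theorem scarRigidity_of_knss
    (h : ∀ (u₁ : ℝ → (EuclideanSpace ℝ (Fin 3)) → (EuclideanSpace ℝ (Fin 3))) (p₁ : ℝ → (EuclideanSpace ℝ (Fin 3)) → ℝ) (u₂ : ℝ → (EuclideanSpace ℝ (Fin 3)) → (EuclideanSpace ℝ (Fin 3))) (p₂ : ℝ → (EuclideanSpace ℝ (Fin 3)) → ℝ) (C : ℝ),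
      IsSuitableWeakSolutionOn (slab (EuclideanSpace ℝ (Fin 3)) (Iio (0 : ℝ)) isOpen_Iio) 1 0 u₁ p₁ → HasTypeIDecay C u₁ →
      IsSuitableWeakSolutionOn (slab (EuclideanSpace ℝ (Fin 3)) (Iio (0 : ℝ)) isOpen_Iio) 1 0 u₂ p₂ → HasTypeIDecay C u₂ →
      IsBackwardSingularPoint u₁ 0 → IsBackwardSingularPoint u₂ 0 → SameScar u₁ u₂ →
      uncurry u₁ =ᵐ[volume.restrict (Iio (0 : ℝ) ×ˢ (univ : Set (EuclideanSpace ℝ (Fin 3))))] uncurry u₂) :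
    ScarRigidity := by
  intro u₁ p₁ _ u₂ p₂ _ C hs₁ _ _ hd₁ hs₂ _ _ hd₂ hsing₁ hsing₂ hscar
  exact h u₁ p₁ u₂ p₂ C hs₁ hd₁ hs₂ hd₂ hsing₁ hsing₂ hscar

/-! ## The two normal forms -/

/-- **MILD NORMAL FORM OF THE CRUX.**  `ScarRigidity` is equivalent to: two smooth Type-I ancient mild fields with the apex
bound `‖Vᵢ(t,x)‖ ≤ C/(‖x‖+√(−t))` (`0 < C`), classical on `(−∞,0)` for pressures with the scale-invariant package, both
backward-singular at the space–time origin and with the same scar, coincide pointwise on `t < 0`.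
[cite: KochNadirashviliSereginSverak2009, §4 Prop. 4.1] [cite: AlbrittonBarker2019, §1] -/
theorem scarRigidity_iff_mild :
    ScarRigidity ↔
      ∀ (V₁ V₂ : ℝ → (EuclideanSpace ℝ (Fin 3)) → (EuclideanSpace ℝ (Fin 3))) (Q₁ Q₂ : ℝ → (EuclideanSpace ℝ (Fin 3)) → ℝ) (C : ℝ), 0 < C →
        IsTypeIAncientMild C V₁ → IsTypeIAncientMild C V₂ → HasTypeIDecay C V₁ → HasTypeIDecay C V₂ →
        IsClassicalNSSolutionOn (Iio (0 : ℝ)) 1 0 V₁ Q₁ → IsClassicalNSSolutionOn (Iio (0 : ℝ)) 1 0 V₂ Q₂ →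
        ScaleInvariantBounds V₁ Q₁ → ScaleInvariantBounds V₂ Q₂ →
        IsBackwardSingularPoint V₁ 0 → IsBackwardSingularPoint V₂ 0 → SameScar V₁ V₂ →
        ∀ t < 0, ∀ x : (EuclideanSpace ℝ (Fin 3)), V₁ t x = V₂ t x :=
  ⟨mildScarRigidity_of_scarRigidity, fun h => scarRigidity_of_knss (knssScarRigidity_of_mild h)⟩

/-- **KNSS FORM OF THE CRUX: the weak gradients and `𝐈 < ∞` are idle.**  `ScarRigidity` is equivalent to: two suitable
weak solutions of Navier–Stokes (`ν = 1`, `f = 0`) on `ℝ³ × (−∞,0)` with the apex bound `‖uᵢ(t,x)‖ ≤ C/(‖x‖+√(−t))`, both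
backward-singular at the origin and with the same scar, coincide a.e. on the slab — no weak gradient, no Albritton–Barker
`𝐈`. [cite: KNSS2009, (1.6)] [cite: AlbrittonBarker2019, §1] -/
theorem scarRigidity_iff_knss :
    ScarRigidity ↔
      ∀ (u₁ : ℝ → (EuclideanSpace ℝ (Fin 3)) → (EuclideanSpace ℝ (Fin 3))) (p₁ : ℝ → (EuclideanSpace ℝ (Fin 3)) → ℝ) (u₂ : ℝ → (EuclideanSpace ℝ (Fin 3)) → (EuclideanSpace ℝ (Fin 3))) (p₂ : ℝ → (EuclideanSpace ℝ (Fin 3)) → ℝ) (C : ℝ),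
        IsSuitableWeakSolutionOn (slab (EuclideanSpace ℝ (Fin 3)) (Iio (0 : ℝ)) isOpen_Iio) 1 0 u₁ p₁ → HasTypeIDecay C u₁ →
        IsSuitableWeakSolutionOn (slab (EuclideanSpace ℝ (Fin 3)) (Iio (0 : ℝ)) isOpen_Iio) 1 0 u₂ p₂ → HasTypeIDecay C u₂ →
        IsBackwardSingularPoint u₁ 0 → IsBackwardSingularPoint u₂ 0 → SameScar u₁ u₂ →
        uncurry u₁ =ᵐ[volume.restrict (Iio (0 : ℝ) ×ˢ (univ : Set (EuclideanSpace ℝ (Fin 3))))] uncurry u₂ :=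
  ⟨fun h => knssScarRigidity_of_mild (mildScarRigidity_of_scarRigidity h), scarRigidity_of_knss⟩

end Summit.NavierStokesRegularity.NavierStokesRegularity.Theorems.RellichScarScarRigidity

end
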